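import Summits.HodgeConjecture.HodgeConjecture.Theorems.F0P6aStubEHECKEOrganMP
import HarnessLib

/-!
# `F0P6aStubEHECKEStageB` — ★ RE-HOME of `Lines/F0_P6a_StubEHECKE.lean`, PART 5 of 6 (size-lint split; cut at a declaration boundary).

## Import provenance
- `Theorems.F0P6aStubEHECKEOrganMP` = ★ previous part of the same `Lines` workfile `F0_P6a_StubEHECKE` (size-lint split ×6); `HarnessLib`.

See PART 1 `Theorems/F0P6aStubEHECKESocket.lean` for the full re-home header and the original module docstring (verbatim there). Namespaces and sections KEPT
(re-opened below exactly as they stand at the cut, with their `open`∕`variable` lines replayed); code bytes = the workfile՚s, docstrings included; options preamble repeated from PART 1.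
HC_CM is proved only modulo the 7 printed citations (2 remaining: hLiu418 = stmt-HodgeConjecture-24832, h413 = stmt-HodgeConjecture-24833) until rung 0 closes; a re-home is count-neutral. -/

set_option autoImplicit false

noncomputable section

namespace Summit.HodgeConjecture.HodgeConjecture.Cruxes.HLiu418.F0P6aStubEHECKE
set_option linter.dupNamespace false
open CategoryTheory CategoryTheory.Limits NumberField IsDedekindDomain MulAction AlgebraicGeometry
open scoped Matrix Polynomial Pointwise
open Literature.NumberTheory.GaloisRepresentations
open Literature.NumberTheory.Automorphic Literature.NumberTheory.Automorphic.UnitaryGroup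
open Literature.AlgebraicGeometry.ShimuraVarieties Literature.AlgebraicGeometry.ShimuraVarieties.UnitaryCanonicalModel
open Literature.NumberTheory.Automorphic.Liu2021.AppendixC
open Literature.AlgebraicGeometry.Motives (AlgPoints ComplexPoints SchemeOver thickeningLift specOver)
open Literature.AlgebraicGeometry.Motives.AbelianVariety (bcSpec)
open Literature.AlgebraicGeometry.AbelianSchemes (PolarizedAbelianSchemeWithLevel AbelianSchemeOver)
open Literature.AlgebraicGeometry.ModuliOfAbelianVarieties
open Summit.HodgeConjecture.HodgeConjecture.Cruxes.HLiu418.F0P6aPELWitnessE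
open Summit.HodgeConjecture.HodgeConjecture.Cruxes.HLiu418.F0P6aStubE6 (RingActionReading Reads)
open Summit.HodgeConjecture.HodgeConjecture.Cruxes.HLiu418.F0P6aEReadings (EHeckeAt HeckeRoofsE RoofE schEOf fibreEOf dualEOf polEOf lvlPtEOf actEOf IsIdealTorsionE)
open Literature.AlgebraicGeometry.AbelianSchemes.AbelianSchemeOver (fibreHom RingAction exists_pointsAlong_mulEquiv_of_eq pointsAlong_map_of_eq
  pointsAlong_forall_map_eq_one_iff_of_eq roof_readAt_comp_of_eq)
open Summit.HodgeConjecture.HodgeConjecture.Cruxes.HLiu418.F0P6aModuliDatumDefs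
open Summit.HodgeConjecture.HodgeConjecture.Cruxes.HLiu418.F0P6aRGDAssembly
open Literature.AlgebraicGeometry.Motives (CMType)
open Literature.AlgebraicGeometry.ShimuraVarieties.UnitaryCanonicalModel.Aux (ratBasis torusFinAdelic)
open Literature.AlgebraicGeometry.ShimuraVarieties.UnitaryCurve Literature.AlgebraicGeometry.ShimuraVarieties.UnitaryCurve.AuxV
open Literature.NumberTheory.ComplexMultiplication.CMTypeOps (flip bar)
open Literature.Geometry.Kaehler (ComplexTorus)
open Summit.HodgeConjecture.HodgeConjecture.Cruxes.HLiu418.F0P6aChartFramePin (IsChartOfFrame)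


/-- ORGAN STUB (O-MP) — see `OrganMP`.  Dealt BY NAME: (O-MP-β) transporter laws (T-ν)(T-Λ)(T-lvl)(T-Λ♭) = ★ p850154∕p850257∕p850267 (LA5-p01 (g3), COMPLETE) + (T-Λc) = L5-#13 (LA5-p02 (g4) frame ★, B-p08 (g35) transport ★); (O-MP-α) STAGE A = `organMP_stageA` below (pen), STAGE B junction body by copy → L5-#11; the body replaces this `sorry` add-only (`obtain ⟨…⟩ := organMP_stageA …` first). -/
theorem stub_MP : OrganMP := by
  intro F _ _ _ _ ι₁ Jstar hJ hJu K₀ S hU7ₛ Kc Fi _ _ _ _ τE hτE Φ hΦ C ξ k Fr hpin ε hε ρ hR N' hN'Kc x'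
  letI : Algebra F ℂ := ι₁.toAlgebra
  letI : Algebra Fi ℂ := τE.toAlgebra
  -- STAGE A (`organMP_stageA`, LA5-plan (g3) pen), opened with `Exists.elim` + projections (the n3-cure)
  refine (organMP_stageA F ι₁ Jstar hJ hJu K₀ S hU7ₛ Kc Fi τE hτE Φ hΦ C ξ k Fr hpin ε hε ρ hR N' hN'Kc x').elim
    fun v h => h.elim fun hv h => h.elim fun a' h => h.elim fun v₁ h => h.elim fun hv₁ h => h.elim fun a₁ h => h.elim fun q₁ h =>
    h.elim fun m₁ h => h.elim fun Θ₁ h => h.elim fun Λ₁ hA => ?_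
  have hF₁ := hA.1
  have hQ₁ := hA.2.2.1
  have hJ₁ := hQ₁.1
  have hq₁ := hQ₁.2.1
  have hM₁ := hQ₁.2.2
  refine ⟨v, hv, a', v₁, hv₁, a₁, q₁, m₁, Θ₁, Λ₁, hF₁, hA.2.1, hQ₁, hA.2.2.2.1, hA.2.2.2.2, ?_⟩
  -- STAGE B, per `(w, hw, hKv, hJi, i, t, ht, htN)` (B-p08 (g35), L5-#11′)
  intro w hw hKv hJi i t ht htN
  -- (R₂) the L6 reading at `y₂ = T_t x′`, at the chart՚s principal pair `(C.u (piece a₂), C.rep (piece a₂))`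
  refine (reads_sheetPt ι₁ τE hτE C ε ρ hR (AlgPoints.map (recordHeckeTranslateGS S hU7ₛ t N' Kc htN) x')).elim
    fun v₂ h => h.elim fun hv₂ h => h.elim fun a₂ hva => ?_
  have hy₂ := hva.1
  have hsp₁ := C.rep_spec (C.piece a₁)
  have hsp₂ := C.rep_spec (C.piece a₂)
  refine (hva.2 (C.u (C.piece a₂)) (C.rep (C.piece a₂)) hsp₂.1 hsp₂.2.1 hsp₂.2.2.1 hsp₂.2.2.2.1 hsp₂.2.2.2.2).elim
    fun m₂ h => h.elim fun Θ₂ h => h.elim fun Λ₂ hΛ => ?_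
  have hγ₂ := hΛ.2.2.2.1
  have hact₂ := hΛ.2.2.2.2.2
  -- (Q₂) the class mover: `[v₂, a₂]_{Kc} = [v, a′ t]_{Kc}` (★ `exists_mover_of_mk_eq_mk_frame` at `pts_map_recordHeckeTranslateGS`)
  have hcl₂ : ShimuraSetGS.mk F Jstar ι₁ Kc.1.1 v₂ hv₂ a₂ = ShimuraSetGS.mk F Jstar ι₁ Kc.1.1 v hv (a' * t) :=
    hy₂.symm.trans (pts_map_recordHeckeTranslateGS ι₁ S hU7ₛ t N' Kc htN x' v hv a' hF₁)
  refine (exists_mover_of_mk_eq_mk_frame C.J C.hJsmul C.b C.bq C.hb C.hJrat Kc.1.1 C.hle C.piece C.Z C.rep C.q C.q_spec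
      (fun b' : 𝓞 F => C.ρ₀ b') (fun a'' (b' : 𝓞 F) => C.Mρ a'' b') C.Mρ_frame C.bq_comm_ρ₀ v₂ hv₂ a₂ v hv (a' * t) hcl₂).elim fun q₂ hq => ?_
  have hJ₂ := hq.1
  have hq₂ := hq.2.1
  have hM₂ := hq.2.2
  -- (MP-J₂) the action reading is `ℂ`-linear (★ p850115 + ★ `map_r_eq_of_map_toFun_mapMatrix`)
  have hMJ₂ : ∀ b : 𝓞 F, (C.Mρ a₂ b).map (Int.cast : ℤ → ℝ) * SiegelModuli.jOfSiegel C.δ (C.Z a₂ v₂) =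
      SiegelModuli.jOfSiegel C.δ (C.Z a₂ v₂) * (C.Mρ a₂ b).map (Int.cast : ℤ → ℝ) := fun b => by
    haveI := ρ.isMonHom b
    exact SiegelAdelicMarking.map_intCast_mul_eq_mul_map_intCast_of_forall_map_r_eq m₂ m₂ _ (C.Mρ a₂ b)
      (fun u => SiegelAdelicMarking.map_r_eq_of_map_toFun_mapMatrix m₂ hγ₂ _ (C.Mρ a₂ b) (hact₂ b) u)
  -- THE PIN: `C.b = ũ_{Fr}(·, 1)` (conjunct 2) and the frame reading of `C.ρ₀` (conjunct 4)
  have hb : ∀ x, C.b x = auxToGspFinV Fr (x, 1) := fun x => by rw [hpin.2.1]; rfl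
  have hq₁' : gspRationalToFinAdelic C.δ q₁ • ((C.rep (C.piece a₁) : ↥(gspFinAdelic C.δ)) : ↥(gspFinAdelic C.δ) ⧸ principalLevelSubgroup C.δ C.N) =
      ((auxToGspFinV Fr (a', 1) : ↥(gspFinAdelic C.δ)) : ↥(gspFinAdelic C.δ) ⧸ principalLevelSubgroup C.δ C.N) := by
    rw [← hb]; exact hq₁
  have hq₂' : gspRationalToFinAdelic C.δ q₂ • ((C.rep (C.piece a₂) : ↥(gspFinAdelic C.δ)) : ↥(gspFinAdelic C.δ) ⧸ principalLevelSubgroup C.δ C.N) =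
      ((auxToGspFinV Fr (a' * t, 1) : ↥(gspFinAdelic C.δ)) : ↥(gspFinAdelic C.δ) ⧸ principalLevelSubgroup C.δ C.N) := by
    rw [← hb]; exact hq₂
  have hKN : ∀ k' ∈ (Kc.1.1 : Subgroup ↥(finAdelic ↥(maximalRealSubfield F) F (IsCMField.complexConj F) 2 Jstar)),
      auxToGspFinV Fr (k', 1) ∈ principalLevelSubgroup C.δ C.N := fun k' hk' => by
    rw [← hb]; exact C.hle hk'
  have hK1 : (Kc.1.1 : Subgroup ↥(finAdelic ↥(maximalRealSubfield F) F (IsCMField.complexConj F) 2 Jstar)).prod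
      (⊥ : Subgroup ↥(torusFinAdelic F)) ≤ auxLevelV Fr 1 := by
    rintro ⟨k', t'⟩ hkt
    have hk' := (Subgroup.mem_prod.1 hkt).1
    have ht' : t' = 1 := (Subgroup.mem_bot).1 (Subgroup.mem_prod.1 hkt).2
    subst ht'
    exact principalLevelSubgroup_anti C.δ (one_dvd C.N) (hKN k' hk')
  -- THE TWIST DATA OF THE PINNED FRAME (★ p850335 `exists_twist_of_frame`)
  refine (exists_twist_of_frame Fr C.ρ₀ hpin.2.2.2 Kc.1.1 ⊥ hK1).elim fun γ h => h.elim fun T₀ h => h.elim fun T₀' htw => ?_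
  have hT'T := htw.1
  have hP := htw.2.1
  have hγS := htw.2.2.1
  have hγ := htw.2.2.2
  have hϖ := HeckeCharacter.valued_uniformizer (K := F) w
  -- (T-J) (T-ρ): frame-free algebra of the movers
  have hTJ := transporter_map_real_mul_eq_mul_of_conjJ q₁ q₂ (C.J v) _ _ hJ₁ hJ₂
  have hTρ := fun b : 𝓞 F =>
    transporter_mul_movedReading_eq_movedReading_mul q₁ q₂ ((C.ρ₀ b).map (Int.cast : ℤ → ℚ)) _ _ (hM₁ b) (hM₂ b)
  -- (T-ν) ★ `transpose_transporter_mul_typeForm_mul_transporter_frame`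
  have hTν := transpose_transporter_mul_typeForm_mul_transporter_frame Fr C.hδ C.N a' t _ _ q₁ q₂ hq₁' hq₂'
    (C.u (C.piece a₁)) (C.u (C.piece a₂)) hsp₁.2.2.2.1 hsp₁.1 hsp₂.2.2.2.1 hsp₂.1 (C.Z_mem a₁ v₁ hv₁) (C.Z_mem a₂ v₂ hv₂) (C.J v) hJ₁ hJ₂
  -- (T-Λ) ★ `transporter_mul_reading_mulVec_mem_latticeOfGL`
  have hTΛ := fun (π : 𝓞 F) (hπ : π ∈ w.asIdeal) (z : Fin C.g ⊕ Fin C.g → ℚ)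
      (hz : z ∈ Literature.NumberTheory.Adeles.latticeOfGL ((C.rep (C.piece a₁) : ↥(gspFinAdelic C.δ)) : GL (Fin C.g ⊕ Fin C.g) finAdeleQ)) =>
    transporter_mul_reading_mulVec_mem_latticeOfGL Fr γ T₀ T₀' hT'T hP hγS C.ρ₀ hpin.2.2.2 Kc.1.1 hγ hJ hw
      (UnitaryGroup.isUnit_placeForm Jstar hJu w) hJi hKv _ hϖ i ht C.N _ _ q₁ q₂ hq₁' hq₂' (C.Mρ a₁) hM₁ hπ hz
  -- (T-Λ♭) ★ `transporter_mulVec_mem_imp_reading_mulVec_mem_latticeOfGL`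
  have hTΛ' := fun (a : 𝓞 F) (ha : a ∈ ((IsCMField.complexConj F) • w).asIdeal) (z : Fin C.g ⊕ Fin C.g → ℚ)
      (hz : (((q₂⁻¹ * q₁ : ↥(gspRational C.δ)) : GL (Fin C.g ⊕ Fin C.g) ℚ) : Matrix (Fin C.g ⊕ Fin C.g) (Fin C.g ⊕ Fin C.g) ℚ) *ᵥ z ∈
        Literature.NumberTheory.Adeles.latticeOfGL ((C.rep (C.piece a₂) : ↥(gspFinAdelic C.δ)) : GL (Fin C.g ⊕ Fin C.g) finAdeleQ)) =>
    transporter_mulVec_mem_imp_reading_mulVec_mem_latticeOfGL Fr γ T₀ T₀' hT'T hP hγS C.ρ₀ hpin.2.2.2 Kc.1.1 hγ hJ hw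
      (UnitaryGroup.isUnit_placeForm Jstar hJu w) hJi hKv _ hϖ i ht C.N _ _ q₁ q₂ hq₁' hq₂' (C.Mρ a₁) hM₁ ha hz
  -- (T-Λc) ★ `transporter_centralKernelLaw` (B-p08, p850301) fed by ★ `forall_reading_mulVec_mem_latticeOfGL_heckeCentral_iff` (LA5-p02 (g4), p850382)
  have hTΛc : i = 2 → ∀ z : Fin C.g ⊕ Fin C.g → ℚ,
      (∀ π ∈ w.asIdeal, ((((q₂⁻¹ * q₁ : ↥(gspRational C.δ)) : GL (Fin C.g ⊕ Fin C.g) ℚ) : Matrix (Fin C.g ⊕ Fin C.g) (Fin C.g ⊕ Fin C.g) ℚ) *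
          (C.Mρ a₁ π).map (Int.cast : ℤ → ℚ)) *ᵥ z ∈ Literature.NumberTheory.Adeles.latticeOfGL
            ((C.rep (C.piece a₂) : ↥(gspFinAdelic C.δ)) : GL (Fin C.g ⊕ Fin C.g) finAdeleQ)) ↔
      (∀ a ∈ ((IsCMField.complexConj F) • w).asIdeal, ((C.Mρ a₁ a).map (Int.cast : ℤ → ℚ)) *ᵥ z ∈ Literature.NumberTheory.Adeles.latticeOfGL
            ((C.rep (C.piece a₁) : ↥(gspFinAdelic C.δ)) : GL (Fin C.g ⊕ Fin C.g) finAdeleQ)) := by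
    intro hi z
    subst hi
    exact transporter_centralKernelLaw Fr C.ρ₀ C.N _ _ q₁ q₂ hq₁' hq₂' (C.Mρ a₁) hM₁
      (fun z' => forall_reading_mulVec_mem_latticeOfGL_heckeCentral_iff Fr γ T₀ T₀' hT'T hP hγS C.ρ₀ hpin.2.2.2 Kc.1.1 hγ hJ hw
        (UnitaryGroup.isUnit_placeForm Jstar hJu w) hJi hKv _ hϖ ht z') z
  -- (T-lvl) ★ `transporter_level_sub_mem_latticeOfGL` at a prime `p ∈ 𝔭_w` prime to the level
  have hTlvl := fun (p : ℕ) (hp : Nat.Prime p) (hpw : (p : 𝓞 F) ∈ w.asIdeal) (hpN : ¬ p ∣ C.N)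
      (y' : Fin C.g ⊕ Fin C.g → ZMod C.N) (w₁ w₂ : Fin C.g ⊕ Fin C.g → ℚ)
      (hw₁ : AdelicCongr (((C.rep (C.piece a₁))⁻¹ : ↥(gspFinAdelic C.δ)) : GL (Fin C.g ⊕ Fin C.g) finAdeleQ) 1 w₁ (fun i => ((y' i).val : ℚ) / C.N))
      (hw₂ : AdelicCongr (((C.rep (C.piece a₂))⁻¹ : ↥(gspFinAdelic C.δ)) : GL (Fin C.g ⊕ Fin C.g) finAdeleQ) 1 w₂ (fun i => ((y' i).val : ℚ) / C.N))
      (π : 𝓞 F) (hπ : π ∈ w.asIdeal) =>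
    transporter_level_sub_mem_latticeOfGL Fr γ T₀ T₀' hT'T hP hγS C.ρ₀ hpin.2.2.2 Kc.1.1 hγ hJ hw
      (UnitaryGroup.isUnit_placeForm Jstar hJu w) hJi hKv _ hϖ i ht C.N hKN hp hpw hpN _ _ q₁ q₂ hq₁' hq₂' (C.Mρ a₁) (C.Mρ a₂) hM₁ hM₂
      y' w₁ w₂ hw₁ hw₂ hπ
  exact ⟨v₂, hv₂, a₂, q₂, m₂, Θ₂, Λ₂, hy₂, hq, hΛ, hMJ₂, hTJ, hTρ, hTν, hTΛ, hTΛ', hTΛc, hTlvl⟩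


set_option maxHeartbeats 400000 in
/-- **ORGAN (O-C) `OrganEC` — THE COMPLEX SIDE.**  The letter՚s hypotheses (chart `C`, comparison `ε` over `C.f` on `τE`-points, action `ρ` extending `C.𝓜.univMul` with the
Kottwitz∕Rosati readings in the L6 markings = `RingActionReading C ε ρ`) and the (U4-w) guards (`w` split, `Kc` hyperspecial at `w|_{F⁺}` with `w`-integral unit form,
`q_{c•w} = p^f`, `p ∤ C.N`) give the HECKE ROOFS OF THE PULLED-BACK TUPLE READ AT EVERY COMPLEX POINT `x′_ℂ` OF `X_{N′}` ON THE SHEET `τE♯` (§1 `HeckeRoofsAt` at `Ω := ℂ`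
through `ι₁`).  This is the complex-uniformisation content of (H-E); skeleton v2 SPLITS it (with `stub_EC_of_organs` PROVED) into: the (O-M) junction ★
`exists_mover_of_mk_eq_mk_frame` (two calls, at `ℓ(u x′)` and `ℓ(T_{rcβ} x′)`, after ★ `S.IsHeckeTranslate` and L6 `Reads`), the lattice law (O-L) (LA5-p01 (g3), ★ target
`UnitaryCurveAuxiliaryHeckeNeighbourLattice`: (L-a)(L-b) integrality of `ρ₀(π)` between `Λ_{b a}` and `Λ_{b(a t)}`, (L-c)(L-c′)(L-d) the lines), the marked-hom family
`h_π` (★ `exists_hom_forall_map_r_eq_of_forall_mem`) and its kernel ∕ card laws (O-H) ★ p849613 (LA5-p02 (g3)), the roof middle `B = A_{y″} ⊗ 𝔭_w⁻¹` with its cover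
(O-B) (★ `SerreTensor*`, LA4-p01 (g2)), exhaustion by the ★ count `q+1`.  A genuine lemma (size XL before the split).  NOT asserted by declaring it.
(print: Liu2021, Lemma C.18 p. 115, Prop. D.8 p. 135) (print: Kottwitz1992, §5 pp. 389–391) (print: RapoportSmithlingZhang2020Diagonal, §4.3 (4.23) p. 21)
(print: Lange2023AbelianVarietiesComplex, §1.2.2 Thm. 1.2.4 (p. 22), §3.4 Proposition 3.4.1) -/
def OrganEC : Prop :=
  ∀ (F : Type) [Field F] [NumberField F] [IsCMField F] [IsGalois ℚ F] (ι₁ : F →+* ℂ)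
    (Jstar : Matrix (Fin 2) (Fin 2) F) (hJ : (Jstar.map (IsCMField.complexConj F))ᵀ = Jstar) (hJu : IsUnit Jstar)
    (K₀ : C5.OpenCompactSubgroup (GSAdele F Jstar)) (S : RecordSystemGS F Jstar ι₁ K₀) (hU7ₛ : S.HeckeTranslateDefinedOver) (Kc : C5.SmallLevel K₀)
    (Fi : Type) [Field Fi] [NumberField Fi] [Algebra F Fi] [IsGalois F Fi] (τE : Fi →+* ℂ) (hτE : τE.comp (algebraMap F Fi) = ι₁)
    (Φ : Set (F →+* ℂ)) (hΦ : IsCMTypeThrough ι₁ Φ) (C : AuxChartGS F ι₁ Jstar K₀ S Kc Fi τE Φ)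
    (ξ : F) (k : ℕ) (Fr : SymplecticFrameV F (RingHom.id F) Jstar ((k : ℚ) • ξ) C.g C.δ) (_hpin : IsChartOfFrame hΦ C ξ k Fr)
    (ε : (Literature.AlgebraicGeometry.Motives.baseChange F Fi).obj (S.M.obj Kc) ⟶
        (Literature.AlgebraicGeometry.Motives.baseChange ℚ Fi).obj C.𝓜.M)
    (_hε : letI : Algebra Fi ℂ := τE.toAlgebra
      ∀ (P : ComplexPoints ((Literature.AlgebraicGeometry.Motives.baseChange F Fi).obj (S.M.obj Kc)))
        (Pflat : letI : Algebra F ℂ := ι₁.toAlgebra; ComplexPoints (S.M.obj Kc)),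
        Pflat.left = P.left ≫ pullback.fst (S.M.obj Kc).hom (bcSpec F Fi) →
        (AlgPoints.map ε P).left ≫ pullback.fst C.𝓜.M.hom (bcSpec ℚ Fi) =
          (letI : Algebra F ℂ := ι₁.toAlgebra; (C.f (S.pts Kc Pflat)).left))
    (ρ : AbelianSchemeOver.RingAction (𝓞 F) (C.𝓜.univ.baseChange (ε.left ≫ pullback.fst C.𝓜.M.hom (bcSpec ℚ Fi))).A),
    RingActionReading C ε ρ →
    ∀ (w : HeightOneSpectrum (𝓞 F)) (hw : (IsCMField.complexConj F) • w ≠ w),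
      UnitaryGroup.IsHyperspecialAt ↥(maximalRealSubfield F) F (IsCMField.complexConj F) 2 Jstar Kc.1.1
          (w.under (𝓞 ↥(maximalRealSubfield F))) →
      (UnitaryGroup.isUnit_placeForm Jstar hJu w).unit ∈ glInt 2 (w.adicCompletion F) →
      ∀ (pChar fDeg : ℕ), Nat.Prime pChar → (pChar : 𝓞 F) ∈ w.asIdeal →
        Nat.card (𝓞 F ⧸ ((IsCMField.complexConj F) • w).asIdeal) = pChar ^ fDeg → ¬ pChar ∣ C.N →
        ∀ (N' : C5.SmallLevel K₀) (hN'Kc : N' ≤ Kc)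
        (rc₁ : orbit (Kc.1.1 : Subgroup ↥(finAdelic ↥(maximalRealSubfield F) F (IsCMField.complexConj F) 2 Jstar))
             ((UnitaryGroup.heckeElementAt ↥(maximalRealSubfield F) F (IsCMField.complexConj F) 2 Jstar
                 (⟨w, rfl⟩ : UnitaryGroup.PlacesOver F (w.under (𝓞 ↥(maximalRealSubfield F))))
                 (IsCMField.complexConj_ne_one F) hJ hw (UnitaryGroup.isUnit_placeForm Jstar hJu w) (HeckeCharacter.uniformizer F w) 1 :
               ↥(finAdelic ↥(maximalRealSubfield F) F (IsCMField.complexConj F) 2 Jstar)) :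
               ↥(finAdelic ↥(maximalRealSubfield F) F (IsCMField.complexConj F) 2 Jstar) ⧸
                 (Kc.1.1 : Subgroup ↥(finAdelic ↥(maximalRealSubfield F) F (IsCMField.complexConj F) 2 Jstar))) →
           ↥(finAdelic ↥(maximalRealSubfield F) F (IsCMField.complexConj F) 2 Jstar))
        (hrc₁ : ∀ β, ((rc₁ β : ↥(finAdelic ↥(maximalRealSubfield F) F (IsCMField.complexConj F) 2 Jstar)) :
            ↥(finAdelic ↥(maximalRealSubfield F) F (IsCMField.complexConj F) 2 Jstar) ⧸
              (Kc.1.1 : Subgroup ↥(finAdelic ↥(maximalRealSubfield F) F (IsCMField.complexConj F) 2 Jstar))) = β.1)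
        (hrcN₁ : ∀ β, C5.HeckeLE (rc₁ β) N' Kc)
        (rc₂ : orbit (Kc.1.1 : Subgroup ↥(finAdelic ↥(maximalRealSubfield F) F (IsCMField.complexConj F) 2 Jstar))
             ((UnitaryGroup.heckeElementAt ↥(maximalRealSubfield F) F (IsCMField.complexConj F) 2 Jstar
                 (⟨w, rfl⟩ : UnitaryGroup.PlacesOver F (w.under (𝓞 ↥(maximalRealSubfield F))))
                 (IsCMField.complexConj_ne_one F) hJ hw (UnitaryGroup.isUnit_placeForm Jstar hJu w) (HeckeCharacter.uniformizer F w) 2 :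
               ↥(finAdelic ↥(maximalRealSubfield F) F (IsCMField.complexConj F) 2 Jstar)) :
               ↥(finAdelic ↥(maximalRealSubfield F) F (IsCMField.complexConj F) 2 Jstar) ⧸
                 (Kc.1.1 : Subgroup ↥(finAdelic ↥(maximalRealSubfield F) F (IsCMField.complexConj F) 2 Jstar))) →
           ↥(finAdelic ↥(maximalRealSubfield F) F (IsCMField.complexConj F) 2 Jstar))
        (hrc₂ : ∀ β, ((rc₂ β : ↥(finAdelic ↥(maximalRealSubfield F) F (IsCMField.complexConj F) 2 Jstar)) :
            ↥(finAdelic ↥(maximalRealSubfield F) F (IsCMField.complexConj F) 2 Jstar) ⧸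
              (Kc.1.1 : Subgroup ↥(finAdelic ↥(maximalRealSubfield F) F (IsCMField.complexConj F) 2 Jstar))) = β.1)
        (hrcN₂ : ∀ β, C5.HeckeLE (rc₂ β) N' Kc)
        (x'c : letI : Algebra F ℂ := ι₁.toAlgebra; AlgPoints (S.M.obj N') ℂ),
        letI : Algebra F ℂ := ι₁.toAlgebra
        letI P := C.𝓜.univ.baseChange (ε.left ≫ pullback.fst C.𝓜.M.hom (bcSpec ℚ Fi))
        HeckeRoofsAt S hU7ₛ hJ hJu Kc w hw P.A ρ P.D P.pol P.level pChar fDeg (sheetHom ι₁ τE hτE) N' hN'Kc rc₁ hrcN₁ rc₂ hrcN₂ x'c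

set_option maxHeartbeats 400000 in
/-- **ORGAN (O-R1) `OrganER1` — THE `t₁`-HALF AT COMPLEX POINTS (LINES + `t₁`-ROOFS).**  In the letter context WITH THE FRAME PIN (`IsChartOfFrame hΦ C ξ k Fr`), for the
pulled-back tuple `P` with reading `RingActionReading C ε ρ`, at every complex point `x′_ℂ` of `X_{N′}` on the sheet `τE♯` and every representative system `rc₁` of `Kc t₁ Kc ∕ Kc`:
the lines `H_β` and the `t₁`-roofs (`HeckeLinesRoofsAt` at `Ω := ℂ`).  ROAD (junction §2b + ★ bricks): reading at the sheet points `ℓ x′`, `T_{rc₁β} x′` (`reads_sheetPt`,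
`pts_map_homOfLE`, `pts_map_recordHeckeTranslateGS`), movers ★ `exists_mover_of_mk_eq_mk_frame` into the frame of ONE representative `(v₀, a₀)` (pin: `C.b = ũ_V∘inl`,
`C.ρ₀` = frame reading), lattice laws (O-L) ★ p849751 + FILE A∕B (LA5-p01∕LA5-p02 (g3)), marked homs `h_π` ★ `exists_hom_forall_map_r_eq_of_forall_mem` and kernels (O-H)
★ p849613∕p849646, `K_β := {P | ∀ π ∈ 𝔭_w, h_π P = 1}`, `H_β := K_β ∩ A_y[𝔭_{c•w}]` (order `q` by ★ `natCard_forall_map_eq_one_and_forall_eq_relIndex` + FILE B), exhaustion by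
counting (★ `natCard_orbit_heckeElementAt_one_uniformizer` = `q+1` = ★ p849754 `natCard_stableAddSubgroup_card_eq`), roof middle `B = A_y ∕ K_β ≅ A_{y″} ⊗ 𝔭_w⁻¹` with
(r1)–(r5) (O-B).  A genuine lemma (size L).  NOT asserted by declaring it. (print: Liu2021, Lemma C.18 p. 115, Prop. D.8 p. 135) (print: Kottwitz1992, §5 pp. 389–391)
(print: Lange2023AbelianVarietiesComplex, §1.2.2 Thm. 1.2.4 (p. 22), §3.4 Proposition 3.4.1) (print: Milne2005ShimuraVarieties, §6 Thm. 6.11) -/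
def OrganER1 : Prop :=
  ∀ (F : Type) [Field F] [NumberField F] [IsCMField F] [IsGalois ℚ F] (ι₁ : F →+* ℂ)
    (Jstar : Matrix (Fin 2) (Fin 2) F) (hJ : (Jstar.map (IsCMField.complexConj F))ᵀ = Jstar) (hJu : IsUnit Jstar)
    (K₀ : C5.OpenCompactSubgroup (GSAdele F Jstar)) (S : RecordSystemGS F Jstar ι₁ K₀) (hU7ₛ : S.HeckeTranslateDefinedOver) (Kc : C5.SmallLevel K₀)
    (Fi : Type) [Field Fi] [NumberField Fi] [Algebra F Fi] [IsGalois F Fi] (τE : Fi →+* ℂ) (hτE : τE.comp (algebraMap F Fi) = ι₁)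
    (Φ : Set (F →+* ℂ)) (hΦ : IsCMTypeThrough ι₁ Φ) (C : AuxChartGS F ι₁ Jstar K₀ S Kc Fi τE Φ)
    (ξ : F) (k : ℕ) (Fr : SymplecticFrameV F (RingHom.id F) Jstar ((k : ℚ) • ξ) C.g C.δ) (_hpin : IsChartOfFrame hΦ C ξ k Fr)
    (ε : (Literature.AlgebraicGeometry.Motives.baseChange F Fi).obj (S.M.obj Kc) ⟶
        (Literature.AlgebraicGeometry.Motives.baseChange ℚ Fi).obj C.𝓜.M)
    (_hε : letI : Algebra Fi ℂ := τE.toAlgebra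
      ∀ (P : ComplexPoints ((Literature.AlgebraicGeometry.Motives.baseChange F Fi).obj (S.M.obj Kc)))
        (Pflat : letI : Algebra F ℂ := ι₁.toAlgebra; ComplexPoints (S.M.obj Kc)),
        Pflat.left = P.left ≫ pullback.fst (S.M.obj Kc).hom (bcSpec F Fi) →
        (AlgPoints.map ε P).left ≫ pullback.fst C.𝓜.M.hom (bcSpec ℚ Fi) =
          (letI : Algebra F ℂ := ι₁.toAlgebra; (C.f (S.pts Kc Pflat)).left))
    (ρ : AbelianSchemeOver.RingAction (𝓞 F) (C.𝓜.univ.baseChange (ε.left ≫ pullback.fst C.𝓜.M.hom (bcSpec ℚ Fi))).A),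
    RingActionReading C ε ρ →
    ∀ (w : HeightOneSpectrum (𝓞 F)) (hw : (IsCMField.complexConj F) • w ≠ w),
      UnitaryGroup.IsHyperspecialAt ↥(maximalRealSubfield F) F (IsCMField.complexConj F) 2 Jstar Kc.1.1
          (w.under (𝓞 ↥(maximalRealSubfield F))) →
      (UnitaryGroup.isUnit_placeForm Jstar hJu w).unit ∈ glInt 2 (w.adicCompletion F) →
      ∀ (pChar fDeg : ℕ), Nat.Prime pChar → (pChar : 𝓞 F) ∈ w.asIdeal →
        Nat.card (𝓞 F ⧸ ((IsCMField.complexConj F) • w).asIdeal) = pChar ^ fDeg → ¬ pChar ∣ C.N →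
        ∀ (N' : C5.SmallLevel K₀) (hN'Kc : N' ≤ Kc)
        (rc₁ : orbit (Kc.1.1 : Subgroup ↥(finAdelic ↥(maximalRealSubfield F) F (IsCMField.complexConj F) 2 Jstar))
             ((UnitaryGroup.heckeElementAt ↥(maximalRealSubfield F) F (IsCMField.complexConj F) 2 Jstar
                 (⟨w, rfl⟩ : UnitaryGroup.PlacesOver F (w.under (𝓞 ↥(maximalRealSubfield F))))
                 (IsCMField.complexConj_ne_one F) hJ hw (UnitaryGroup.isUnit_placeForm Jstar hJu w) (HeckeCharacter.uniformizer F w) 1 :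
               ↥(finAdelic ↥(maximalRealSubfield F) F (IsCMField.complexConj F) 2 Jstar)) :
               ↥(finAdelic ↥(maximalRealSubfield F) F (IsCMField.complexConj F) 2 Jstar) ⧸
                 (Kc.1.1 : Subgroup ↥(finAdelic ↥(maximalRealSubfield F) F (IsCMField.complexConj F) 2 Jstar))) →
           ↥(finAdelic ↥(maximalRealSubfield F) F (IsCMField.complexConj F) 2 Jstar))
        (hrc₁ : ∀ β, ((rc₁ β : ↥(finAdelic ↥(maximalRealSubfield F) F (IsCMField.complexConj F) 2 Jstar)) :
            ↥(finAdelic ↥(maximalRealSubfield F) F (IsCMField.complexConj F) 2 Jstar) ⧸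
              (Kc.1.1 : Subgroup ↥(finAdelic ↥(maximalRealSubfield F) F (IsCMField.complexConj F) 2 Jstar))) = β.1)
        (hrcN₁ : ∀ β, C5.HeckeLE (rc₁ β) N' Kc)
        (x'c : letI : Algebra F ℂ := ι₁.toAlgebra; AlgPoints (S.M.obj N') ℂ),
        letI : Algebra F ℂ := ι₁.toAlgebra
        letI P := C.𝓜.univ.baseChange (ε.left ≫ pullback.fst C.𝓜.M.hom (bcSpec ℚ Fi))
        HeckeLinesRoofsAt S hU7ₛ hJ hJu Kc w hw P.A ρ P.D P.pol P.level pChar fDeg (sheetHom ι₁ τE hτE) N' hN'Kc rc₁ hrcN₁ x'c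


/-! ### (O-R1) THE JUNCTION — `stub_ER1_of_MP : OrganMP → OrganER1` (A-p13 (g39), L5-#8′) -/

set_option maxHeartbeats 400000 in
/-- **(O-R1) PAID FROM (O-MP)** — the lines `H_β` and the `t₁`-roofs at every complex point: STAGE A of `OrganMP` (one reading `m₁` of `y₁ = ℓ x′`, mover
`q₁`), the twist datum of the pinned frame (★ `exists_twist_of_frame`), the line lattices in reading currency (★ `exists_heckeLineLattices`: the six inputs of ★
`exists_stableLines` + the per-β reader), ★ `SiegelAdelicMarking.exists_stableLines` (conjuncts (1)(2)(3) of `HeckeLinesRoofsAt`), and per β STAGE B at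
`(i := 1, t := rc₁ β)` + ★ `exists_heckeLineRoof_of_markedReadings` (conjunct (4)).  Kernel-checked modulo the `OrganMP` hypothesis.
[cite: Kottwitz1992, §5 pp. 389–391] [cite: ShimuraIATAF1971, §3.2, §7.3] [cite: Milne2005ShimuraVarieties, §6 Thm. 6.11 p. 74 and p. 75] -/
theorem stub_ER1_of_MP (hMP : OrganMP) : OrganER1 := by
  intro F _ _ _ _ ι₁ Jstar hJ hJu K₀ S hU7ₛ Kc Fi _ _ _ _ τE hτE Φ hΦ C ξ k Fr hpin ε hε ρ hR w hw hKv hJi pChar fDeg hp hpw hq hpN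
    N' hN'Kc rc₁ hrc₁ hrcN₁ x'c
  letI : Algebra F ℂ := ι₁.toAlgebra
  letI : Algebra Fi ℂ := τE.toAlgebra
  classical
  -- ## STAGE A of (O-MP), opened by `Exists.elim` + projections (no `cases` re-targeting of the large goal)
  -- CURRENCY (437 797 → 270 624 heartbeats, LA3-p01 (g7) 2026-09-03): `OrganMP` reads fibres at `(sheetPt …).left`, the goal (`OrganER1`∕`fibreAt`) at `(thickeningLift …).left` (★ `sheetPt_left`, `rfl`) — rewrite the PACKED (O-MP) statement ONCE, so `m₁` and all data extracted from it are in the goal's currency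
  have hA0 := hMP F ι₁ Jstar hJ hJu K₀ S hU7ₛ Kc Fi τE hτE Φ hΦ C ξ k Fr hpin ε hε ρ hR N' hN'Kc x'c
  simp only [sheetPt_left] at hA0
  refine hA0.elim fun v hA => hA.elim fun hv hA => hA.elim fun a' hA =>
    hA.elim fun v₁ hA => hA.elim fun hv₁ hA => hA.elim fun a₁ hA => hA.elim fun q₁ hA => hA.elim fun m₁ hA => hA.elim fun Θ₁ hA => hA.elim fun Λ₁ hA => ?_
  have hQ₁cl := hA.2.2.1.2.1
  have hQ₁M := hA.2.2.1.2.2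
  have hamp₁ := hA.2.2.2.1.1
  have hΘ₁ := hA.2.2.2.1.2.1
  have hrd₁ := hA.2.2.2.1.2.2.1
  have hγ₁ := hA.2.2.2.1.2.2.2.1
  have hact₁ := hA.2.2.2.1.2.2.2.2.2
  have hMJ₁ := hA.2.2.2.2.1
  have hB := hA.2.2.2.2.2
  -- ## E-side bookkeeping: `c`, `hcc`, `𝔭′ = c𝔭`, `𝔡`, Rosati, `N ≠ 0`
  let cc : 𝓞 F ≃+* 𝓞 F := MulSemiringAction.toRingEquiv (F ≃ₐ[↥(maximalRealSubfield F)] F) (𝓞 F) (IsCMField.complexConj F)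
  have hc : ∀ y : 𝓞 F, ((cc y : 𝓞 F) : F) = (IsCMField.complexConj F) (y : F) := fun _ => rfl
  have hcc : ∀ y, cc (cc y) = y := fun y => by
    apply RingOfIntegers.ext
    rw [hc, hc, IsCMField.complexConj_apply_apply]
  have h𝔭c : w.asIdeal.map (cc : 𝓞 F →+* 𝓞 F) = ((IsCMField.complexConj F) • w).asIdeal := by
    rw [show ((IsCMField.complexConj F) • w).asIdeal = (IsCMField.complexConj F) • w.asIdeal from rfl, Ideal.pointwise_smul_def]
    rfl
  have hp𝔭' : (pChar : 𝓞 F) ∈ ((IsCMField.complexConj F) • w).asIdeal := by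
    rw [← h𝔭c, ← map_natCast (cc : 𝓞 F →+* 𝓞 F) pChar]
    exact Ideal.mem_map_of_mem _ hpw
  have hne : w.asIdeal ≠ ((IsCMField.complexConj F) • w).asIdeal := fun h => hw (HeightOneSpectrum.ext h.symm)
  haveI := w.isMaximal
  haveI := ((IsCMField.complexConj F) • w).isMaximal
  have hcop : IsCoprime w.asIdeal ((IsCMField.complexConj F) • w).asIdeal :=
    (Ideal.isCoprime_iff_sup_eq).2 (Ideal.IsMaximal.coprime_of_ne inferInstance inferInstance hne)
  obtain ⟨𝔡, hpd⟩ : w.asIdeal * ((IsCMField.complexConj F) • w).asIdeal ∣ Ideal.span {(pChar : 𝓞 F)} :=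
    hcop.mul_dvd (Ideal.dvd_span_singleton.mpr hpw) (Ideal.dvd_span_singleton.mpr hp𝔭')
  have hros : ∀ b : 𝓞 F, haveI := ρ.isMonHom b
      ρ.i (cc b) ≫ (C.𝓜.univ.baseChange (ε.left ≫ pullback.fst C.𝓜.M.hom (bcSpec ℚ Fi))).pol.lam = (C.𝓜.univ.baseChange (ε.left ≫ pullback.fst C.𝓜.M.hom (bcSpec ℚ Fi))).pol.lam ≫ AbelianSchemeOver.DualPair.dualIsogenyOver (ρ.i b) (C.𝓜.univ.baseChange (ε.left ≫ pullback.fst C.𝓜.M.hom (bcSpec ℚ Fi))).D (C.𝓜.univ.baseChange (ε.left ≫ pullback.fst C.𝓜.M.hom (bcSpec ℚ Fi))).D :=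
    fun b => Summit.HodgeConjecture.HodgeConjecture.Cruxes.HLiu418.F0P6aStubE6.rosatiOver_of_ringActionReading hτE C ε ρ hR b (cc b) (hc b)
  have hN : C.N ≠ 0 := by have := C.hN; omega
  have hpQ : (pChar : ℚ) ≠ 0 := Nat.cast_ne_zero.2 hp.ne_zero
  -- ## the pin: `C.b = ũ_{Fr}(·, 1)`; the level containment; the twist datum of the frame (★ `exists_twist_of_frame`)
  have hb : ∀ x : ↥(finAdelic (↥(maximalRealSubfield F)) F (IsCMField.complexConj F) 2 Jstar), C.b x = auxToGspFinV Fr (x, 1) := fun x => by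
    rw [hpin.2.1]; rfl
  have hKle : (Kc.1.1 : Subgroup ↥(finAdelic (↥(maximalRealSubfield F)) F (IsCMField.complexConj F) 2 Jstar)).prod (⊥ : Subgroup ↥(torusFinAdelic F)) ≤ auxLevelV Fr 1 := by
    rintro ⟨x, t⟩ ⟨hx, ht⟩
    have ht1 : t = 1 := Subgroup.mem_bot.1 ht
    subst ht1
    rw [mem_auxLevelV_iff, ← hb]
    exact principalLevelSubgroup_anti C.δ (one_dvd C.N) (C.hle hx)
  obtain ⟨γ, T, T', hT'T, hP, hγS, hγ⟩ := exists_twist_of_frame Fr C.ρ₀ hpin.2.2.2 (Kc.1.1 : Subgroup ↥(finAdelic (↥(maximalRealSubfield F)) F (IsCMField.complexConj F) 2 Jstar)) ⊥ hKle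
  have hTT' : T * T' = 1 := (Matrix.mul_eq_one_comm_of_card_eq _ _ _ (card_sum_eq_card_prod_of_frame Fr)).2 hT'T
  have hQ₁cl' : gspRationalToFinAdelic C.δ q₁ • ((C.rep (C.piece a₁) : ↥(gspFinAdelic C.δ)) : ↥(gspFinAdelic C.δ) ⧸ principalLevelSubgroup C.δ C.N) =
      ((auxToGspFinV Fr (a', 1) : ↥(gspFinAdelic C.δ)) : ↥(gspFinAdelic C.δ) ⧸ principalLevelSubgroup C.δ C.N) := by
    rw [← hb]; exact hQ₁cl
  -- ## THE LINE LATTICES in reading currency (★ `exists_heckeLineLattices`)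
  obtain ⟨Hfam, hΛH, h𝔞H, hinjH, hcardH, hstH, hexhH, hreadH⟩ :=
    exists_heckeLineLattices Fr γ T T' hTT' hT'T hP hγS C.ρ₀ hpin.2.2.2 (Kc.1.1 : Subgroup ↥(finAdelic (↥(maximalRealSubfield F)) F (IsCMField.complexConj F) 2 Jstar)) hγ hJ hw
      (UnitaryGroup.isUnit_placeForm Jstar hJu w) hJi hKv a' (C.rep (C.piece a₁)) q₁ hQ₁cl' (C.Mρ a₁) hQ₁M rc₁ hrc₁
  -- ## THE LINES through the marking `m₁` (★ `exists_stableLines`)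
  let ιA : 𝓞 F → ((((C.𝓜.univ.baseChange (ε.left ≫ pullback.fst C.𝓜.M.hom (bcSpec ℚ Fi))).A.fibre (thickeningLift (sheetHom ι₁ τE hτE) (S.M.obj Kc) (AlgPoints.map (S.M.map (homOfLE hN'Kc)) x'c)).left).toAbelianVariety) ⟶ (((C.𝓜.univ.baseChange (ε.left ≫ pullback.fst C.𝓜.M.hom (bcSpec ℚ Fi))).A.fibre (thickeningLift (sheetHom ι₁ τE hτE) (S.M.obj Kc) (AlgPoints.map (S.M.map (homOfLE hN'Kc)) x'c)).left).toAbelianVariety)) := fun b =>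
    haveI := ρ.isMonHom b
    AbelianSchemeOver.fibreHom (ρ.i b) (thickeningLift (sheetHom ι₁ τE hτE) (S.M.obj Kc) (AlgPoints.map (S.M.map (homOfLE hN'Kc)) x'c)).left
  have hιA : ∀ (b : 𝓞 F) (u : Fin C.g ⊕ Fin C.g → ℚ),
      AlgPoints.map (ιA b).hom.hom.hom (m₁.r u) = m₁.r ((C.Mρ a₁ b).map (Int.cast : ℤ → ℚ) *ᵥ u) := fun b u =>
    m₁.map_r_eq_of_map_toFun_mapMatrix hγ₁ (ιA b) (C.Mρ a₁ b) (hact₁ b) u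
  let q₀ : GL (Fin C.g ⊕ Fin C.g) ℚ := Units.map (Matrix.scalar (Fin C.g ⊕ Fin C.g)).toMonoidHom (Units.mk0 (pChar : ℚ) hpQ)
  have hMp : (C.Mρ a₁ (pChar : 𝓞 F)).map (Int.cast : ℤ → ℚ) = (pChar : ℚ) • (1 : Matrix (Fin C.g ⊕ Fin C.g) (Fin C.g ⊕ Fin C.g) ℚ) := by
    rw [map_natCast]
    ext i j
    rw [Matrix.map_apply, Matrix.natCast_apply, Matrix.smul_apply, Matrix.one_apply]
    split_ifs <;> simp
  have hq₀ : ((q₀ : GL (Fin C.g ⊕ Fin C.g) ℚ) : Matrix (Fin C.g ⊕ Fin C.g) (Fin C.g ⊕ Fin C.g) ℚ) = (C.Mρ a₁ (pChar : 𝓞 F)).map (Int.cast : ℤ → ℚ) := by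
    rw [hMp]
    change Matrix.scalar (Fin C.g ⊕ Fin C.g) (pChar : ℚ) = _
    rw [Matrix.scalar_apply, Matrix.smul_one_eq_diagonal]
  obtain ⟨Hβ, hHβ, hinjβ, hβfacts, hexhβ⟩ :=
    SiegelAdelicMarking.exists_stableLines m₁ ιA (fun b => (C.Mρ a₁ b).map (Int.cast : ℤ → ℚ)) hιA
      (((IsCMField.complexConj F) • w).asIdeal : Set (𝓞 F)) hp𝔭' q₀ hq₀ Hfam (pChar ^ fDeg) hΛH h𝔞H hinjH
      (fun β => (hcardH β).trans hq) hstH (fun L h₁ h₂ h₃ h₄ => hexhH L h₁ h₂ (h₃.trans hq.symm) h₄)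
  -- ## ASSEMBLY on the reader-side normal form: unfold the readers; the goal STAYS in the `thickeningLift` currency of `fibreAt` (no `← sheetPt_left` fold)
  dsimp only [HeckeLinesRoofsAt, RoofAt, IsIdealTorsionAt, actAt, lvlPtAt, fibreAt, schAt, dualAt, polAt]
  -- line data vs `OrganER1` binders now differ only by abstracted nested proofs (`OrganMP._proof_k` ∕ `HeckeLinesRoofsAt._proof_k`) and `∈ ↑I` ∕ `∈ I`: close by congruence
  simp only [ιA] at hβfacts hexhβ
  with_reducible_and_instances refine ⟨Hβ, hinjβ, hβfacts, hexhβ, fun β => ?_⟩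
  -- conjunct (4) at `β`: STAGE B at `(i := 1, t := rc₁ β)` (again by `Exists.elim` + projections), then ★ `exists_heckeLineRoof_of_markedReadings`
  refine (hB w hw hKv hJi 1 (rc₁ β) (by rw [hrc₁ β]; exact β.2) (hrcN₁ β)).elim fun v₂ hS => hS.elim fun hv₂ hS => hS.elim fun a₂ hS =>
    hS.elim fun q₂ hS => hS.elim fun m₂ hS => hS.elim fun Θ₂ hS => hS.elim fun Λ₂ hS => ?_
  have hQ₂cl := hS.2.1.2.1
  have hamp₂ := hS.2.2.1.1
  have hΘ₂ := hS.2.2.1.2.1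
  have hrd₂ := hS.2.2.1.2.2.1
  have hγ₂ := hS.2.2.1.2.2.2.1
  have hact₂ := hS.2.2.1.2.2.2.2.2
  have hTJ := hS.2.2.2.2.1
  have hTM := hS.2.2.2.2.2.1
  have hTν := hS.2.2.2.2.2.2.1
  have hTΛ := hS.2.2.2.2.2.2.2.1
  have hTlvl := hS.2.2.2.2.2.2.2.2.2.2
  have hQ₂cl' : gspRationalToFinAdelic C.δ q₂ • ((C.rep (C.piece a₂) : ↥(gspFinAdelic C.δ)) : ↥(gspFinAdelic C.δ) ⧸ principalLevelSubgroup C.δ C.N) =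
      ((auxToGspFinV Fr (a' * rc₁ β, 1) : ↥(gspFinAdelic C.δ)) : ↥(gspFinAdelic C.δ) ⧸ principalLevelSubgroup C.δ C.N) := by
    rw [← hb]; exact hQ₂cl
  refine (Literature.AlgebraicGeometry.ModuliOfAbelianVarieties.exists_heckeLineRoof_of_markedReadings
      (C.𝓜.univ.baseChange (ε.left ≫ pullback.fst C.𝓜.M.hom (bcSpec ℚ Fi))).A ρ (C.𝓜.univ.baseChange (ε.left ≫ pullback.fst C.𝓜.M.hom (bcSpec ℚ Fi))).D (C.𝓜.univ.baseChange (ε.left ≫ pullback.fst C.𝓜.M.hom (bcSpec ℚ Fi))).pol (C.𝓜.univ.baseChange (ε.left ≫ pullback.fst C.𝓜.M.hom (bcSpec ℚ Fi))).level hN (C.𝓜.univ.baseChange (ε.left ≫ pullback.fst C.𝓜.M.hom (bcSpec ℚ Fi))).relDim cc hcc hros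
      (thickeningLift (sheetHom ι₁ τE hτE) (S.M.obj Kc) (AlgPoints.map (S.M.map (homOfLE hN'Kc)) x'c)).left
      (sheetPt ι₁ τE hτE S Kc (AlgPoints.map (recordHeckeTranslateGS S hU7ₛ (rc₁ β) N' Kc (hrcN₁ β)) x'c)).left
      m₁ m₂ hγ₁ hγ₂
      (C.rep_spec (C.piece a₁)).1 (C.rep_spec (C.piece a₂)).1 (C.rep_spec (C.piece a₁)).2.2.2.1 (C.rep_spec (C.piece a₂)).2.2.2.1
      Λ₁ Λ₂ hamp₁ hamp₂ hΘ₁ hΘ₂ hrd₁ hrd₂ (C.Mρ a₁) (C.Mρ a₂) hact₁ hact₂ hMJ₁ _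
      (Units.isUnit ((q₂⁻¹ * q₁ : ↥(gspRational C.δ)) : GL (Fin C.g ⊕ Fin C.g) ℚ)) hTJ hTM hTν
      w.asIdeal ((IsCMField.complexConj F) • w).asIdeal 𝔡 h𝔭c hp hpw w.ne_bot hpd.symm hTΛ (hTlvl pChar hp hpw hpN)
      (Hfam β) (hreadH β (C.rep (C.piece a₂)) q₂ hQ₂cl')).elim fun Kβ hK => ?_
  exact ⟨Kβ, fun Pt => (hHβ β Pt).trans (hK.1 Pt), hK.2⟩

/-- ORGAN STUB (O-R1) — see `OrganER1`.  PAID (A-p13 (g39), L5-#8′): `stub_ER1_of_MP stub_MP` — the lines and `t₁`-roofs from the marked pair (O-MP)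
through ★ `exists_heckeLineLattices`, ★ `SiegelAdelicMarking.exists_stableLines` and ★ `exists_heckeLineRoof_of_markedReadings`. -/
theorem stub_ER1 : OrganER1 := stub_ER1_of_MP stub_MP

end Summit.HodgeConjecture.HodgeConjecture.Cruxes.HLiu418.F0P6aStubEHECKE
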